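import Summits.HodgeConjecture.HodgeConjecture.Theorems.H413ThetaPinBridge
import Literature.NumberTheory.Automorphic.Liu2021.Def411WeilCarriersAtLineClassTransportPU
import HarnessLib

/-!
# Crux `H413` — THE THETA PIN BRIDGE WITHOUT THE SOCKET (C′): the line move by the ★ UNCONDITIONAL MASTER
# `exists_omegaAtLine_equiv_rhoVAtLine_of_locF_eq` (F0P4-p06 (g0), p795659)

HC_CM is proved only modulo the 7 printed citations until rung 0 closes.

F0P2-p02 (g0), 2026-08-30 (sequel of ★ `Theorems/H413ThetaPinBridge.lean`, p793582).  PROOF FILE (theorems only, no `def`, no `sorry`) for crux item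
`stmt-HodgeConjecture-24833`.  v1 of the bridge took TWO sockets, (C) `Rogawski1990.cohFinComponent_isTheta` and (C′) `Def411WeilCarriers.rhoAtLine_lineClassTransport`;
since then programme P4's S4a road LANDED the line-class transport as a THEOREM at the frame `Equiv.prodUnique (Fin N) (Fin 1)` for every rank `N ≥ 1`
(★ `Def411WeilCarriers.exists_omegaAtLine_equiv_rhoVAtLine_of_locF_eq`, `Liu2021/Def411WeilCarriersAtLineClassTransportPU.lean`: a `U(diag dV)(𝔸_{L⁺,f})`-equivariant
LINEAR EQUIVALENCE of the carriers at two lines with the same finite local norm classes).  The pin reads its carriers at exactly that frame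
(`HodgeCM.Model.ArchSideTerm.e₁ = Equiv.prodUnique (Fin 3) (Fin 1)`) and rank `3`, so the socket (C′) is no longer needed THERE:

* `exists_intertwiner_repLine_of_master` — at rank `N ≥ 1` and the frame `Equiv.prodUnique`, for any faithful section `r : Rep`, `ω(μ, ε_a, χ)_f` at `⟨a⟩` EMBEDS
  (injective intertwiner along any `ιV`) into its realisation at the representative line `⟨r (locF a)⟩` — the ★ master's `≃` read as an intertwiner of
  `rhoAtLine … ιV = rhoVAtLine ∘ ιV` (`rfl`);
* **`spectrumIsTheta_of_cohFinComponent_of_master (hC : cohFinComponent_isTheta) : ‹hB›`** — the SAME conclusion as v1's `spectrumIsTheta_of_cohFinComponent hC hC′`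
  (F0P2-p03's binder `hB`, token for token) from the engine letter (C) ALONE.  Consumers: `P2StubU2OfLetters.stubU2_of_letters hD hD′ (… _of_master hC)`
  closes U2′ modulo {(C), (D)} ((D̄) ⇐ (D) by ★ `antiholCotFormSpectralProjection_of_hol`, F0P2-p01 (g2)).

Why (C′) itself is not discharged here: the letter quantifies over EVERY rank `N′` (including the degenerate `N′ = 0`, where the master's `0 < N` does not apply);
its instances at `0 < N′` follow from the master and the ★ `e`-reindex brick (`Def411WeilCarriersDoubling.exists_omegaAtLine_equiv_rhoVAtLine_reindex`, F0P4-p04).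

Sources: [Liu2021, Def. 4.11–4.12, proof of Prop. 4.13 l. 2140–2146, App. D §D.1 Step 1 footnote l. 5215, Lem. D.1]; [Rogawski1990, Thm. 13.3.6 (c), §15.3];
[GelbartRogawski1991, Thm. 5.1.1, Lem. 5.1.2, §3.1]; [BushnellHenniart2006, §4.2–4.3]; [MoeglinVignerasWaldspurger1987, Chap. 3 I.1–I.3]; [Flath1979, §2].
-/

set_option autoImplicit false

-- the mandated namespace has the single-problem summit's repeated segment (`HodgeConjecture.HodgeConjecture`), as in every `Cruxes/…` module of this sub-problem
set_option linter.dupNamespace false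

noncomputable section

namespace Summit.HodgeConjecture.HodgeConjecture.Cruxes.H413.ThetaPinBridge

open scoped TensorProduct Matrix
open NumberField NumberField.InfinitePlace IsDedekindDomain MeasureTheory
open HodgeCM.Model HodgeCM.Model.LiuIndex HodgeCM.Model.TowerCarrier
open Summit.HodgeConjecture.CorCM.Model
open Literature.AlgebraicGeometry.Motives (CMType AbelianVariety)
open Literature.AlgebraicGeometry.HodgeTheory Literature.NumberTheory.Automorphic.PicardCM
open Literature.AlgebraicGeometry.ShimuraVarieties Literature.AlgebraicGeometry.ShimuraVarieties.UnitaryCanonicalModel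
open Literature.NumberTheory.ComplexMultiplication
open Literature.NumberTheory.Automorphic
open Literature.NumberTheory.Automorphic.Liu2021 Literature.NumberTheory.Automorphic.Liu2021.AppendixC
open Literature.NumberTheory.Automorphic.Liu2021.Def411WeilCarriers
open Literature.NumberTheory.Automorphic.Liu2021.Def411WeilCarriersDoubling
open Literature.NumberTheory.Automorphic.IdeleClassGroup
open Literature.NumberTheory.GelbartRogawski1991 Literature.NumberTheory.GelbartRogawski1991.UnitaryDualPair
open Literature.RepresentationTheory Literature.RepresentationTheory.Liu2021
open Literature.NumberTheory.Rogawski1990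
open Summit.HodgeConjecture.CorCM
open Summit.HodgeConjecture.CorCM.Transposition
open Summit.HodgeConjecture.CorCM.Transposition.OmegaTransport (realUnit)
open HodgeCM.Model.ArchSideTerm (e₁)
open Literature.NumberTheory.GelbartRogawski1991.OscillatorTripleDictionary (OccursInH1 IsIsoToOmega rhoTriple)
open MulAction
open Literature.Geometry.ComplexHyperbolic.BallModel (U21 x₀)
open Summit.HodgeConjecture.CorCM.Lines.A3Liu413 (datum413)
open Summit.HodgeConjecture.HodgeConjecture.Cruxes.H413.CohFormsCarriers
open Summit.HodgeConjecture.HodgeConjecture.Cruxes.H413.SpectrumInterfaces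

/-! ## §1  The line move by the ★ master (no pin) -/

section Master

variable (L : Type) [Field L] [NumberField L] [IsCMField L]

set_option maxHeartbeats 3200000 in
/-- **(C′) AT THE FRAME `Equiv.prodUnique`, RANK `N ≥ 1`, FROM THE ★ MASTER**: for any faithful representative section `r : Rep L⁺ d`, `ω(μ, ε_a, χ)_f` at `⟨a⟩`
EMBEDS `G`-equivariantly (along any `ιV : G →* U(diag dV)(𝔸_{L⁺,f})`) into its realisation at the representative line `⟨r (locF a)⟩` — the master
`exists_omegaAtLine_equiv_rhoVAtLine_of_locF_eq` at `h := (r.locF_toFun (locF a) ⟨a, rfl⟩).symm`, its `≃ₗ` read as an injective intertwiner of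
`rhoAtLine … ιV = rhoVAtLine ∘ ιV` (`rfl`). [cite: Liu2021, App. D §D.1 Step 1 footnote (l. 5215)] [cite: MoeglinVignerasWaldspurger1987, Chap. 3 I.1–I.3] -/
theorem exists_intertwiner_repLine_of_master {N : ℕ} (hN : 0 < N)
    (dV : Fin N → L) (hdV : ∀ i, IsCMField.complexConj L (dV i) = dV i) (hdV0 : ∀ i, dV i ≠ 0)
    (χV : Literature.NumberTheory.GaloisRepresentations.HeckeCharacter L) (hχu : χV.IsUnitary)
    (hχs : Literature.RepresentationTheory.HarrisKudlaSweet1996.IsSplittingChar L 1 χV)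
    {G : Type} [Group G] [TopologicalSpace G]
    (ιV : G →* UnitaryGroup.finAdelic (↥(maximalRealSubfield L)) L (IsCMField.complexConj L) N (Matrix.diagonal dV))
    (χ : Chi (↥(maximalRealSubfield L)) L (IsCMField.complexConj L))
    (r : Rep (↥(maximalRealSubfield L)) (imagUnitSq L)) (a : (↥(maximalRealSubfield L))ˣ) :
    ∃ e' : (rhoAtLine (↥(maximalRealSubfield L)) L (IsCMField.complexConj L) N (Equiv.prodUnique (Fin N) (Fin 1)) (Matrix.diagonal dV)
              (complexConj_imagUnit L) (imagUnit_ne_zero L) (imagUnit_mul_self L) (realDiagonal_isSymm L dV hdV)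
              (isUnit_det_realDiagonal L dV hdV hdV0) (realDiagonal_map L dV hdV).symm
              (fun b => isCompatible_chiSplittingLine L (Equiv.prodUnique (Fin N) (Fin 1)) dV hdV hdV0 χV hχu hχs
                (TW (↥(maximalRealSubfield L)) b) (isSymm_TW (↥(maximalRealSubfield L)) b)
                (isUnit_det_TW (↥(maximalRealSubfield L)) b) (JW (↥(maximalRealSubfield L)) L b)
                (JW_eq (↥(maximalRealSubfield L)) L b))
              ιV a χ).IntertwiningMap
            (rhoAtLine (↥(maximalRealSubfield L)) L (IsCMField.complexConj L) N (Equiv.prodUnique (Fin N) (Fin 1)) (Matrix.diagonal dV)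
              (complexConj_imagUnit L) (imagUnit_ne_zero L) (imagUnit_mul_self L) (realDiagonal_isSymm L dV hdV)
              (isUnit_det_realDiagonal L dV hdV hdV0) (realDiagonal_map L dV hdV).symm
              (fun b => isCompatible_chiSplittingLine L (Equiv.prodUnique (Fin N) (Fin 1)) dV hdV hdV0 χV hχu hχs
                (TW (↥(maximalRealSubfield L)) b) (isSymm_TW (↥(maximalRealSubfield L)) b)
                (isUnit_det_TW (↥(maximalRealSubfield L)) b) (JW (↥(maximalRealSubfield L)) L b)
                (JW_eq (↥(maximalRealSubfield L)) L b))
              ιV (r.toFun (locF (↥(maximalRealSubfield L)) (imagUnitSq L) a)) χ),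
        Function.Injective e' := by
  obtain ⟨Ψ, hΨ⟩ := exists_omegaAtLine_equiv_rhoVAtLine_of_locF_eq L hN dV hdV hdV0 χV hχu hχs χ a
    (r.toFun (locF (↥(maximalRealSubfield L)) (imagUnitSq L) a)) (r.locF_toFun _ ⟨a, rfl⟩).symm
  exact ⟨Ψ.toLinearMap.intertwiningMap_of_isIntertwiningMap _ _ (fun g x => hΨ (ιV g) x), Ψ.injective⟩

end Master

/-! ## §2  The bridge at the pin from (C) alone -/

set_option synthInstance.maxHeartbeats 400000 in
set_option maxHeartbeats 8000000 in
/-- **THE THETA PIN BRIDGE FROM THE ENGINE LETTER (C) ALONE** (v2 of `spectrumIsTheta_of_cohFinComponent`, same conclusion = F0P2-p03's binder `hB` token for token):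
for every face, every automorphic `μ`, every irreducible smooth `σ` of `U(V)(𝔸_{F⁺,f})` and every discrete automorphic `Π` that is `H¹`-cohomological of type
`(1,0)` or `(0,1)` at the factor of record with finite component `σ`, there are a compact open `K` and a triple `t` of the PRINTED datum with `μ_t` of weight one,
`ε_t` global, and `σ`, `ω_t` Hecke-related at level `K`.  Steps as in v1 — (C) at the pin, `t := ⟨μc, hμc, locF a, χ⟩`, `isGlobal_line` — except that the move
from `⟨a⟩` to the datum's representative line `⟨(Rep.update … Rep.ofLineOf …).toFun (locF a)⟩` is the ★ THEOREM `exists_intertwiner_repLine_of_master` (rank 3,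
frame `e₁ = Equiv.prodUnique (Fin 3) (Fin 1)`), not the socket (C′). [cite: Liu2021, Def. 4.11–4.12; proof of Prop. 4.13 l. 2140–2146; App. D §D.1 Step 1 footnote, Lem. D.1]
[cite: Rogawski1990, Thm. 13.3.6; §15.3] [cite: GelbartRogawski1991, Thm 5.1.1 p. 465; Lemma 5.1.2 p. 466] [cite: BushnellHenniart2006, §4.2–4.3] -/
theorem spectrumIsTheta_of_cohFinComponent_of_master (hC : cohFinComponent_isTheta) :
    ∀ (hDel : canonicalModel_exists_printed) (F : HodgeCM.CMField) [IsGalois ℚ F] (h6 : 6 ≤ Module.finrank ℚ F) {ι₁ : F →+* ℂ}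
      (V : HodgeCM.HermSpace3 F ι₁) (a₀ : RealScalar F) (Φ : CMType F) (hΦ : ι₁ ∈ Φ.1) (i : I V (repAt a₀) (muLiu ι₁ GramClass.rep))
      (μ : Measure (adelicDatum F V).automorphicQuotient) [(adelicDatum F V).IsAutomorphicMeasure μ]
      (W : Type) [AddCommGroup W] [Module ℂ W] (σ : Representation ℂ ↥(HodgeCM.HermSpace3.adelicFin V) W),
      σ.IsIrreducible → σ.IsSmooth →
        ∀ P : DiscreteAutomorphicRep (adelicDatum F V) μ,
          (P.IsHolCotangentAt (archFactorOf F V).ιinf (archFactorOf F V).Kc ∨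
              P.IsAntiholCotangentAt (archFactorOf F V).ιinf (archFactorOf F V).Kc) →
            P.HasFinComponent σ →
              ∃ K : Subgroup ↥(HodgeCM.HermSpace3.adelicFin V),
                IsOpen (K : Set ↥(HodgeCM.HermSpace3.adelicFin V)) ∧ IsCompact (K : Set ↥(HodgeCM.HermSpace3.adelicFin V)) ∧
                  ∃ t : (datum413 hDel F V a₀ Φ i).Triple, t.HasWeightOne ∧ IsGlobalEps (datum413 hDel F V a₀ Φ i) t.ε ∧
                    HeckeRelatedAt K σ (rhoTriple (datum413 hDel F V a₀ Φ i) t) := by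
  intro hDel F _ h6 ι₁ V a₀ Φ hΦ i μ _ W _ _ σ hirr hsm P hP hfin
  -- (1) the engine letter (C) at the pin
  have h2 : 2 ≤ Module.finrank ℚ ↥(maximalRealSubfield (HodgeCM.CMField.K F)) :=
    two_le_finrank_maximalRealSubfield (HodgeCM.CMField.K F) h6
  haveI : (UnitaryGroup.adelicGroupData (↥(maximalRealSubfield (HodgeCM.CMField.K F))) (HodgeCM.CMField.K F)
      (IsCMField.complexConj (HodgeCM.CMField.K F)) 3 (HodgeCM.HermSpace3.Hm V)).IsAutomorphicMeasure μ := ‹_›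
  obtain ⟨μc, hμc, hw, a, χ, f, hf⟩ :=
    hC (HodgeCM.CMField.K F) ι₁ (HodgeCM.HermSpace3.Hm V) V.sylvesterFrame (HodgeCM.Model.sylvesterFrame_J V) V.posDef_of_ne h2
      e₁ (frameD V) (frameD_real V) (frameD_ne V) (frameG V) (frame_congr V) (ιVE V)
      (fun k => coe_finFrameCongr (HodgeCM.CMField.K F) V.Hm (frameG V) (frameD V) (frame_congr V) k)
      μ W σ hirr hsm P hP hfin
  -- (2) the triple of the printed datum and the globality of its `ε`
  let t : (datum413 hDel F V a₀ Φ i).Triple :=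
    ⟨μc, hμc, locF (↥(maximalRealSubfield (HodgeCM.CMField.K F))) (imagUnitSq (HodgeCM.CMField.K F)) a, χ⟩
  have hglob : IsGlobalEps (datum413 hDel F V a₀ Φ i) t.ε := isGlobal_line (HodgeCM.CMField.K F) a
  -- (3) move the line to the datum's representative by the ★ MASTER (rank 3, frame `e₁ = Equiv.prodUnique (Fin 3) (Fin 1)`)
  obtain ⟨e', he'⟩ := exists_intertwiner_repLine_of_master (HodgeCM.CMField.K F) (by norm_num : 0 < 3) (frameD V) (frameD_real V)
    (frameD_ne V) (toHeckeCharacter (HodgeCM.CMField.K F) μc) (isUnitary_toHeckeCharacter (HodgeCM.CMField.K F) μc)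
    ((isOscillatorChar_toHeckeCharacter_iff μc).mpr hμc) (ιVE V) χ
    (Rep.update (↥(maximalRealSubfield (HodgeCM.CMField.K F))) (imagUnitSq (HodgeCM.CMField.K F))
      (Rep.ofLineOf (↥(maximalRealSubfield (HodgeCM.CMField.K F))) (imagUnitSq (HodgeCM.CMField.K F)))
      (locF (↥(maximalRealSubfield (HodgeCM.CMField.K F))) (imagUnitSq (HodgeCM.CMField.K F))
        (realUnit ⟨HodgeCM.CMField.K F⟩ (repAt a₀ (Sigma.fst i)).1 (repAt a₀ (Sigma.fst i)).2.1 (repAt a₀ (Sigma.fst i)).2.2))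
      (realUnit ⟨HodgeCM.CMField.K F⟩ (repAt a₀ (Sigma.fst i)).1 (repAt a₀ (Sigma.fst i)).2.1 (repAt a₀ (Sigma.fst i)).2.2) rfl)
    a
  obtain ⟨g, hg⟩ : ∃ g : σ.IntertwiningMap (rhoTriple (datum413 hDel F V a₀ Φ i) t), Function.Injective g :=
    exists_injective_comp f hf e' he'
  -- (4) Hecke-relatedness at a compact open level
  obtain ⟨K, hKo, hKc, hrel⟩ :=
    Literature.NumberTheory.Automorphic.exists_heckeRelated_of_intertwiningMap σ (rhoTriple (datum413 hDel F V a₀ Φ i) t)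
      (UnitaryGroup.finAdelicIntegralLevel (↥(maximalRealSubfield (HodgeCM.CMField.K F))) (HodgeCM.CMField.K F)
        (IsCMField.complexConj (HodgeCM.CMField.K F)) 3 (HodgeCM.HermSpace3.Hm V))
      (UnitaryGroup.isCompact_finAdelicIntegralLevel _ _ _ _ _) (UnitaryGroup.isOpen_finAdelicIntegralLevel _ _ _ _ _)
      hirr hsm g hg
  exact ⟨K, hKo, hKc, t, hw, hglob, hrel⟩

end Summit.HodgeConjecture.HodgeConjecture.Cruxes.H413.ThetaPinBridge

end
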